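import Literature.AnabelianGeometry.EtaleTheta.Discharge.Sec3Prop34CnstOfRlfRChainModel
import Literature.AnabelianGeometry.EtaleTheta.DivisorMonoidsConstants34
import HarnessLib

/-!
# [EtTh] Prop 3.4 (ii), third isomorphism `L^× ⥲ F₀(Y)`: the predicate bundle `Prop34Const` HOLDS at the `Ÿ`-type
# chain model (a non-vacuity witness with INFINITELY many primes and an infinitely supported `div(ϖ_L)`)

Proof-only companion (theorems only) of `Discharge/Sec3Prop34CnstOfRlfRChainModel.lean` (this seat) and of
abc-iut-L2-t3's `DivisorMonoidsConstants34.lean` (`DivisorMonoids.Prop34Const`, v-next census item A1), cell abc-iut,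
sub-DAG `plan/L2/SUBDAG-EtTh-Thm37.md`.  S. Mochizuki, *The étale theta function …* [EtTh], Prop. 3.4 (ii) PDF p.74
("`L^× ⥲ F₀(Y^log)`"; `div(c) = v_L(c)·div(ϖ_L)`, `div(ϖ_L)` = the special fibre with multiplicities)
[cite: MochizukiEtTh2009, Prop 3.4 (ii) p.74].

The only non-vacuity witness of `Prop34Const` so far is the one-prime toy (`Toy.prop34Const`).  THIS FILE: at the
chain model `Sec3Prop34CnstOfRlfRChainModel.dm` (primes = components ⊔ cusps `≅ ℤ ⊔ ℤ`, `Φ₀ = ∏ ℚ_{≥0}`,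
`B₀ = (ℤ → ℤ)` with the dual-graph law (L), `F₀` = constants) the bundle holds with `d := div(𝟙)` = `1` at EVERY
component, `0` at every cusp — an infinitely supported, non-cuspidal, nonzero log-divisor attained by the constant
`𝟙 = ϖ`, and `div₀(c) = dᶜ` for every constant `c` (`prop34Const`).  Hence census items A1 (`Prop34Const`) and A2
(`hE`, `Sec3Prop34CnstOfRlfRChainModel.eff`) are JOINTLY satisfiable at `Ÿ`-type data with infinitely many primes.
HONEST FRAMING: a model over the cell's abstract interfaces; nothing here bears on [IUTchIII] Cor. 3.12.
-/

noncomputable section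

namespace Literature.AnabelianGeometry.EtaleTheta

open CategoryTheory Opposite Literature.AlgebraicGeometry.Frobenioids

namespace Sec3Prop34CnstOfRlfRChainModel

/-- The special-fibre log-divisor `d := div(𝟙)⁺`: `1` at every component, `0` at every cusp (an element of `Φ₀`).
[cite: MochizukiEtTh2009, Prop 3.4 (ii) p.74] -/
theorem negPart_D_unif : PiNNRat.negPart (D (Multiplicative.toAdd unif)) = 1 := by
  funext i
  rcases i with j | j
  · rfl
  · simp [PiNNRat.negPart, unif, D_inr, lap]

/-- `div₀(𝟙) = [d]` with `d = div(𝟙)⁺ ∈ Φ₀` (no negative part). [cite: MochizukiEtTh2009, Prop 3.4 (ii) p.74] -/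
theorem divH_unif : divH unif = Algebra.GrothendieckGroup.of (PiNNRat.posPart (D (Multiplicative.toAdd unif))) := by
  rw [divH_apply, PiNNRat.toGp, negPart_D_unif, map_one, div_one]

/-- `d ≠ 0`: its component-`0` coordinate is `1`. [cite: MochizukiEtTh2009, Prop 3.4 (ii) p.74] -/
theorem posPart_D_unif_ne_one : PiNNRat.posPart (D (Multiplicative.toAdd unif)) ≠ 1 := by
  intro h
  have h1 := congr_fun h (Sum.inl 0)
  simp [PiNNRat.posPart, unif, D_inl] at h1

/-- The divisor vector of a constant `c` is `c` times that of `𝟙`. [cite: MochizukiEtTh2009, Prop 3.4 (ii) p.74] -/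
theorem D_const (c : ℤ) : D (fun _ => c) = c • D (Multiplicative.toAdd unif) := by
  funext i
  rcases i with j | j
  · simp [unif, D_inl]
  · simp only [unif, D_inr, lap, Pi.smul_apply, smul_eq_mul, toAdd_ofAdd]
    ring

/-- `toGp (c • v) = (toGp v)ᶜ` (by the joint injectivity of the rational coordinates).
[cite: MochizukiFrdI2008, Def. 2.4(i) p.47] -/
theorem toGp_zsmul (c : ℤ) (v : I → ℤ) : PiNNRat.toGp (c • v) = PiNNRat.toGp v ^ c :=
  PiNNRat.eq_of_c_eq fun i => by rw [PiNNRat.c_toGp, PiNNRat.c_zpow, PiNNRat.c_toGp, Pi.smul_apply, smul_eq_mul,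
    Int.cast_mul]

/-- **`Prop34Const` HOLDS at the `Ÿ`-type chain model** (`F₀` = constants is a group; `d = div(𝟙)` non-cuspidal,
`≠ 0`, attained by the constant `𝟙`; `div₀(c) = dᶜ`) — a non-vacuity witness with infinitely many primes.
[cite: MochizukiEtTh2009, Prop 3.4 (ii) p.74] -/
theorem prop34Const : dm.Prop34Const where
  inv_mem_F₀ Y b hb := by
    obtain ⟨c, hc⟩ := hb
    refine ⟨((show B from b)⁻¹ : B), ⟨-c, ?_⟩, ?_⟩
    · rw [toAdd_inv, (hc : Multiplicative.toAdd (show B from b) = fun _ => c)]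
      rfl
    · change ((show B from b)⁻¹ * (show B from b) : B) = 1
      exact inv_mul_cancel _
  exists_specialFibre Y := by
    refine ⟨PiNNRat.posPart (D (Multiplicative.toAdd unif)), trivial, posPart_D_unif_ne_one,
      ⟨unif, unif_mem, divH_unif⟩, fun b hb => ?_⟩
    obtain ⟨c, hc⟩ := hb
    refine ⟨c, ?_⟩
    change divH b = (Algebra.GrothendieckGroup.of (PiNNRat.posPart (D (Multiplicative.toAdd unif))) :
      Algebra.GrothendieckGroup M) ^ c
    rw [divH_apply, hc, D_const, toGp_zsmul, ← divH_unif, divH_apply]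

end Sec3Prop34CnstOfRlfRChainModel

end Literature.AnabelianGeometry.EtaleTheta

end
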